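import Mathlib
import Summits.NavierStokesRegularity.NavierStokesRegularity.Theorems.WakeRatchetTailRatchetQuietPastFloor
import Summits.NavierStokesRegularity.NavierStokesRegularity.Theorems.TransitMassLedgerActionTransitExtractionSmallAmplitudeRung
import HarnessLib

/-!
# `WakeRatchet.TailRatchet` (stmt-NavierStokesRegularity-21808) — the backward amplitude floor, UNIFORM ON THE CLASS E₂(R)

Support file (route `WakeRatchet`; MODEL lattice ODEs of Tao 2016 §4 / §6.4 — nothing here concerns the Navier–Stokes
equations; no item is closed).  Companion of `WakeRatchetTailRatchetQuietPast` / `…QuietPastFloor`.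

On a table of Tao's class `InTableClass R` (m = 4) at scale ratio `1+ε₀`, `0 < ε₀ ≤ 1`, the table constant
`C_Q + Λ C_A + Λ⁻¹ C_B` is at most `704` (tree: `ActionTransitExtraction.SmallAmplitudeRung.quadConst_le`), so the
backward floor of the companion file becomes a CLASS-UNIFORM constant, independent of `R`, `α`, `ν̂`, `ε₀ ∈ (0,1]`:

* `eq_zero_of_quiet_past_of_inTableClass` — a uniformly bounded admissible eternal solution (any `ν̂ ≥ 0`) with
  `‖W_k(σ)‖ ≤ 1/2816` for every shell and every `σ ≤ σ₁` (some `σ₁`) is identically zero;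
* `past_loud_of_inTableClass` / `past_loud_of_inTableClass_inviscid` — a non-trivial one exceeds `1/2816` at some shell at
  arbitrarily negative log-times: for every `σ₁` there are `n` and `σ ≤ σ₁` with `‖W_n(σ)‖ > 1/2816`.

This is the form consumed by compactness arguments over FAMILIES of eternal solutions on E₂(R) tables (α-limits, frames):
the far past of every member of the hypothesis class of stmt-21808 / 25584 / 25646 / 25647 is loud by a universal amount.
(The tree's global floor `WakeRatchetEternalFloor` gives the larger, `ε₀`-dependent amplitude `1/(896 ε₀)` somewhere in
space-time, but not in every past half-line.)

HONEST FRAMING: elementary; stmt-21808 is neither proved nor refuted here (dead modulo the construction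
`WakeRatchetDyadicFront.DyadicScalarFronts`).
-/

noncomputable section

set_option linter.dupNamespace false

namespace Summit.NavierStokesRegularity.NavierStokesRegularity.Theorems

namespace WakeRatchetQuietPast

open Set Filter Topology
open Literature.Analysis.FluidPDE Literature.Analysis.FluidPDE.TaoCascade
open Summit.NavierStokesRegularity.NavierStokesRegularity.Cruxes.ActionTransitExtraction.SmallAmplitudeRung
  (quadConst quadConst_le)

variable {ε₀ νh R : ℝ} {α : Fin 4 → Fin 4 → Fin 4 → ℤ × ℤ × ℤ → ℝ} {W : ℤ → ℝ → Em 4}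

/-- **Class-uniform quiet-past Liouville.**  On an E₂(R) table with `0 < ε₀ ≤ 1`, a uniformly bounded admissible eternal
solution (any covariant viscosity `ν̂ ≥ 0`) whose every shell is `≤ 1/2816` in norm at every log-time `σ ≤ σ₁` is identically
zero (`K ≤ 704`, `704/2816 = 1/4`). [cite: Tao2016AveragedNS, §4 (4.1)–(4.3), Lemma 4.1 (4.8), §6.4; cell theorem] -/
theorem eq_zero_of_quiet_past_of_inTableClass (hε : 0 < ε₀) (hε1 : ε₀ ≤ 1) (hα : InTableClass R α)
    (hW : IsEternalVisc ε₀ νh α W) (hU : UniformBound W) {σ₁ : ℝ}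
    (hq : ∀ (k : ℤ) (σ : ℝ), σ ≤ σ₁ → ‖W k σ‖ ≤ 1 / 2816) : ∀ (n : ℤ) (σ : ℝ), W n σ = 0 := by
  have hK : shiftConst α (0, 0, 0) + bigLam ε₀ * shiftConst α (0, 0, 1)
      + (bigLam ε₀)⁻¹ * (shiftConst α (1, 0, 0) + shiftConst α (0, 1, 0)) ≤ 704 :=
    quadConst_le hε hε1 hα
  exact eq_zero_of_quiet_past (by linarith) hW hU hK (by norm_num) (by norm_num) hq

/-- **Class-uniform backward amplitude floor.**  A non-trivial uniformly bounded admissible eternal solution of an E₂(R)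
table (`0 < ε₀ ≤ 1`, any `ν̂ ≥ 0`) has, for every `σ₁`, a shell `n` and a log-time `σ ≤ σ₁` with `‖W_n(σ)‖ > 1/2816`.
[cite: Tao2016AveragedNS, §4 (4.1)–(4.3), Lemma 4.1 (4.8), §6.4; cell theorem] -/
theorem past_loud_of_inTableClass (hε : 0 < ε₀) (hε1 : ε₀ ≤ 1) (hα : InTableClass R α)
    (hW : IsEternalVisc ε₀ νh α W) (hU : UniformBound W) (hne : ∃ (n : ℤ) (σ : ℝ), W n σ ≠ 0) (σ₁ : ℝ) :
    ∃ (n : ℤ) (σ : ℝ), σ ≤ σ₁ ∧ 1 / 2816 < ‖W n σ‖ := by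
  by_contra h
  push Not at h
  obtain ⟨n, σ, hnz⟩ := hne
  exact hnz (eq_zero_of_quiet_past_of_inTableClass hε hε1 hα hW hU (fun k σ hσ => h k σ hσ) n σ)

/-- The class-uniform floor on the INVISCID class `IsEternal` (hypothesis class of `stub_inviscid` of the line `birth`
and of stmt-25646). [cite: Tao2016AveragedNS, §4 Lemma 4.1 (4.8); cell theorem] -/
theorem past_loud_of_inTableClass_inviscid (hε : 0 < ε₀) (hε1 : ε₀ ≤ 1) (hα : InTableClass R α)
    {W : ℤ → ℝ → Em 4} (hW : IsEternal ε₀ α W) (hU : UniformBound W) (hne : ∃ (n : ℤ) (σ : ℝ), W n σ ≠ 0)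
    (σ₁ : ℝ) : ∃ (n : ℤ) (σ : ℝ), σ ≤ σ₁ ∧ 1 / 2816 < ‖W n σ‖ :=
  past_loud_of_inTableClass hε hε1 hα hW.isEternalVisc hU hne σ₁

/-- **Filter form.**  For a non-trivial uniformly bounded admissible eternal solution of an E₂(R) table,
`sup_n ‖W_n(σ)‖ > 1/2816` FREQUENTLY as `σ → −∞` (`∃ᶠ σ in atBot, ∃ n, 1/2816 < ‖W_n(σ)‖`).
[cite: Tao2016AveragedNS, §4 Lemma 4.1 (4.8), §6.4; cell theorem] -/
theorem frequently_loud_atBot (hε : 0 < ε₀) (hε1 : ε₀ ≤ 1) (hα : InTableClass R α)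
    (hW : IsEternalVisc ε₀ νh α W) (hU : UniformBound W) (hne : ∃ (n : ℤ) (σ : ℝ), W n σ ≠ 0) :
    ∃ᶠ σ in atBot, ∃ n : ℤ, 1 / 2816 < ‖W n σ‖ := by
  rw [frequently_atBot]
  intro σ₁
  obtain ⟨n, σ, hσ, hlt⟩ := past_loud_of_inTableClass hε hε1 hα hW hU hne σ₁
  exact ⟨σ, hσ, n, hlt⟩

end WakeRatchetQuietPast

end Summit.NavierStokesRegularity.NavierStokesRegularity.Theorems

end
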